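import Summits.BirchSwinnertonDyer.BirchSwinnertonDyer.Theorems.ManinLocalTwoThreeNewformPinningFortyEight
import HarnessLib

/-!
# Level 48: the `η`-identities of `X₀(48) → 48a1` reduce to three `q`-asymptotics at `i∞` — the cusp `1/24`
# handled by the `W = (1 0; 24 1)`-symmetry

Cell bsd-f2-manin, route `ManinLocalTwoThree` (crux C2 `ManinOddAtFour`, stmt-22967: `2² ∣ 48`), prover seat p2 gen 26; level-`48`
analogue of `EtaIdentityReductionTwentyFour` (first level with `g(X₀(N)) > 1`).

OBJECTS (`η`-quotients of level `48` found by the cusp-order search of the seat folder, `scripts/explore2.py`, certified in exact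
arithmetic to `O(q⁷⁰)`, `scripts/rel48.py`): `x = η₈⁴η₁₂²/(η₄²η₂₄⁴) = q⁻² + 2q² + q⁶ + ⋯`, `y = η₂η₆η₈³η₁₂²/(η₄²η₂₄⁵) = q⁻³ − q⁻¹ + q − 3q³ + ⋯`,
`φ₄₈ = η₄⁴η₁₂⁴/(η₂η₆η₈η₂₄)` (`NewformFortyEight`).  Unlike the genus-one levels, `x` and `y` have poles at TWO cusps, `∞` and `1/24`
(the fibre of `X₀(48) → 48a1` over `O`; orders `−2, −2` and `−3, −3`).  IDENTITIES: **`y² = x³ − 2x² − 3x`** — Cremona's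
`48a1 = [0, 1, 0, −4, −4]` translated by `1` (`c₄ = 208`, `c₆ = 2240`, `Δ = 2⁸3²`) — and `x′ = −2πiφ₄₈·2y`, `y′ = −2πiφ₄₈·(3x² − 4x − 3)`;
with `X = x − ⅔`: `(X′)² = (2πiφ₄₈)²(4X³ − (52/3)X − 280/27)`.

* §1 The general-`N` cusp-form argument of `EtaIdentityReductionThirtySix`, re-cut so that vanishing at the cusps off `Γ₀(N)` is a
  hypothesis dischargeable cusp by cusp (`exists_cuspForm_of'`, `deriv_eq_of_tendsto_pow_of`), with a general vanishing order `q^m`.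
* §2 `x, y` are `Γ₀(48)`-invariant (Newman); at the cusps `a/c` with `24 ∤ c` they are bounded (Ligozat orders `≥ 0`); at the cusp
  `1/24` (`24 ∣ c`, `48 ∤ c`) one has `A = g·W`, `g ∈ Γ₀(48)`, `W = (1 0; 24 1)`, and `x∘W = x`, `y∘W = −y`, `φ₄₈|W = −φ₄₈`
  (`NewformFortyEight.etaQuotient24_smul_W`, log periods `0`, `−½`, `½`), so `R|A = R|W = ±R` for the two combinations
  `R₁ = (2πi)⁻¹x′ + φ₄₈·2y`, `R₂ = (2πi)⁻¹y′ + φ₄₈(3x² − 4x − 3)`.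
* The sequel `…PeriodLatticeFortyEight` turns (T1) `R₁/q⁶ → 0`, (T2) `R₂/q⁶ → 0` (Sturm at `48`) and (T3) `x³ − 2x² − 3x − y² → 0`
  into the identities and **(S2)₄₈ `Λ(φ₄₈) ⊆ Λ(52/3, 280/27)`**; the limits and the squeeze are `…EtaIdentitiesFortyEight`.

HONEST FRAMING: unconditional; hypotheses are (T1)–(T3) only.  Nothing here proves C2, Manin's conjecture or BSD.  No definition, no
named fact, no sorry. [cite: Ligozat1975, Ch. 3–4] [cite: CremonaAlgorithms1997, Table 1 (48a1), §2.10] [cite: DiamondShurman2005, §1.2, Thm. 3.5.1]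
-/

set_option autoImplicit false
-- lint-debt: the directory name repeats the summit name (sibling precedent `ManinLocalTwoThreeEtaIdentityReductionTwentyFour.lean`)
set_option linter.dupNamespace false

noncomputable section

open Complex Filter Topology Set Function Asymptotics
open UpperHalfPlane hiding I
open scoped Real Topology Manifold MatrixGroups ModularForm
open ModularForm CongruenceSubgroup
open Literature.NumberTheory.EllipticCurves Literature.NumberTheory.EllipticCurves.ModularForms

namespace Summit.BirchSwinnertonDyer.BirchSwinnertonDyer.Theorems.ManinLocalTwoThree.EtaIdentityReductionFortyEight

open CuspToolkit AnalyticBridge EtaIdentityReductionThirtySix NewformFortyEight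

/-! ## §1 The cusp-form argument at level `N`, with the behaviour at the cusps as a hypothesis -/

section General

variable {N : ℕ} [NeZero N]

omit [NeZero N] in
/-- `R = (2πi)⁻¹x′ + φ·y` is `Γ₀(N)`-slash-invariant in weight `2` when `x, y` are `Γ₀(N)`-invariant. [cite: DiamondShurman2005, §1.2] -/
theorem slash_eq_self_of_mem (φ : CuspForm (Gamma0 N) 2) (x y : ℍ → ℂ) (hx : MDifferentiable 𝓘(ℂ) 𝓘(ℂ) x)
    (hxinv : ∀ γ : SL(2, ℤ), γ ∈ Gamma0 N → ∀ τ : ℍ, x (γ • τ) = x τ)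
    (hyinv : ∀ γ : SL(2, ℤ), γ ∈ Gamma0 N → ∀ τ : ℍ, y (γ • τ) = y τ) {γ : SL(2, ℤ)} (hγ : γ ∈ Gamma0 N) :
    ((fun σ : ℍ ↦ (2 * π * I)⁻¹ * deriv (x ∘ ofComplex) σ + φ σ * y σ) ∣[(2 : ℤ)] γ)
      = fun σ : ℍ ↦ (2 * π * I)⁻¹ * deriv (x ∘ ofComplex) σ + φ σ * y σ := by
  have hφinv : (⇑φ ∣[(2 : ℤ)] γ) = ⇑φ := by
    have h := SlashInvariantForm.slash_action_eqn φ _ ⟨γ, hγ, rfl⟩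
    rw [SL_slash]
    exact h
  funext τ
  rw [slash_two_apply_of φ y hx γ τ, hφinv, hyinv γ hγ τ, show (fun σ : ℍ ↦ x (γ • σ)) = x from funext (hxinv γ hγ)]

/-- At a cusp where `x∘A` and `y∘A` are bounded, `R|A → 0` (Cauchy's estimate for `(x∘A)′`, `φ|A → 0`). [cite: DiamondShurman2005, §1.2] -/
theorem isZeroAtImInfty_slash_of_isBoundedAtImInfty (φ : CuspForm (Gamma0 N) 2) (x y : ℍ → ℂ)
    (hx : MDifferentiable 𝓘(ℂ) 𝓘(ℂ) x) (A : SL(2, ℤ)) (hxb : IsBoundedAtImInfty (fun τ : ℍ ↦ x (A • τ)))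
    (hyb : IsBoundedAtImInfty (fun τ : ℍ ↦ y (A • τ))) :
    IsZeroAtImInfty ((fun σ : ℍ ↦ (2 * π * I)⁻¹ * deriv (x ∘ ofComplex) σ + φ σ * y σ) ∣[(2 : ℤ)] A) := by
  have hfun : ((fun σ : ℍ ↦ (2 * π * I)⁻¹ * deriv (x ∘ ofComplex) σ + φ σ * y σ) ∣[(2 : ℤ)] A)
      = fun τ : ℍ ↦ (2 * π * I)⁻¹ * deriv ((fun σ : ℍ ↦ x (A • σ)) ∘ ofComplex) τ + (⇑φ ∣[(2 : ℤ)] A) τ * y (A • τ) :=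
    funext (slash_two_apply_of φ y hx A)
  rw [hfun]
  have h1 : IsZeroAtImInfty (fun τ : ℍ ↦ deriv ((fun σ : ℍ ↦ x (A • σ)) ∘ ofComplex) τ) :=
    isZeroAtImInfty_deriv_of_isBoundedAtImInfty (CuspToolkit.mdifferentiable_comp_smul hx A) hxb
  have h2 : IsZeroAtImInfty (⇑φ ∣[(2 : ℤ)] A) := CuspFormClass.zero_at_infty_slash φ A
  exact ((const_boundedAtFilter atImInfty ((2 * π * I)⁻¹ : ℂ)).mul_zeroAtFilter h1).add (h2.mul_boundedAtFilter hyb)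

/-- **`R = (2πi)⁻¹x′ + φ·y` is a cusp form on `Γ₀(N)`** when `φ ∈ S₂(Γ₀(N))`, `x, y` are holomorphic and `Γ₀(N)`-invariant,
`R|A → 0` at `i∞` for every `A ∉ Γ₀(N)`, and `R → 0` at `i∞`. [cite: DiamondShurman2005, §1.2] -/
theorem exists_cuspForm_of' (φ : CuspForm (Gamma0 N) 2) (x y : ℍ → ℂ) (hx : MDifferentiable 𝓘(ℂ) 𝓘(ℂ) x)
    (hy : MDifferentiable 𝓘(ℂ) 𝓘(ℂ) y)
    (hxinv : ∀ γ : SL(2, ℤ), γ ∈ Gamma0 N → ∀ τ : ℍ, x (γ • τ) = x τ)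
    (hyinv : ∀ γ : SL(2, ℤ), γ ∈ Gamma0 N → ∀ τ : ℍ, y (γ • τ) = y τ)
    (hzero : ∀ A : SL(2, ℤ), A ∉ Gamma0 N →
      IsZeroAtImInfty ((fun σ : ℍ ↦ (2 * π * I)⁻¹ * deriv (x ∘ ofComplex) σ + φ σ * y σ) ∣[(2 : ℤ)] A))
    (h0 : IsZeroAtImInfty (fun σ : ℍ ↦ (2 * π * I)⁻¹ * deriv (x ∘ ofComplex) σ + φ σ * y σ)) :
    ∃ S : CuspForm (Gamma0 N) 2, ∀ τ : ℍ, S τ = (2 * π * I)⁻¹ * deriv (x ∘ ofComplex) τ + φ τ * y τ := by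
  have hdiffx := UpperHalfPlane.mdifferentiable_iff.mp hx
  refine ⟨{ toFun := fun σ : ℍ ↦ (2 * π * I)⁻¹ * deriv (x ∘ ofComplex) σ + φ σ * y σ
            slash_action_eq' := ?_
            holo' := ?_
            zero_at_cusps' := ?_ }, fun τ ↦ rfl⟩
  · intro A hA
    obtain ⟨γ, hγ, rfl⟩ := hA
    rw [slash_mapGL]
    exact slash_eq_self_of_mem φ x y hx hxinv hyinv hγ
  · rw [UpperHalfPlane.mdifferentiable_iff]
    have hD : DifferentiableOn ℂ (deriv (x ∘ ofComplex)) {z : ℂ | 0 < z.im} :=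
      (hdiffx.analyticOnNhd isOpen_upperHalfPlaneSet).deriv.differentiableOn
    have hφ := UpperHalfPlane.mdifferentiable_iff.mp (CuspFormClass.holo φ)
    have hy' := UpperHalfPlane.mdifferentiable_iff.mp hy
    have h : DifferentiableOn ℂ (fun z : ℂ ↦ (2 * π * I)⁻¹ * deriv (x ∘ ofComplex) z
        + (φ ∘ ofComplex) z * (y ∘ ofComplex) z) {z : ℂ | 0 < z.im} :=
      (hD.const_mul _).add (hφ.mul hy')
    refine h.congr fun z hz ↦ ?_
    simp only [Function.comp_apply, ofComplex_apply_of_im_pos hz]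
    rfl
  · intro c hc
    rw [Subgroup.IsArithmetic.isCusp_iff_isCusp_SL2Z] at hc
    rw [OnePoint.isZeroAt_iff_forall_SL2Z hc]
    intro A _
    show IsZeroAtImInfty ((fun σ : ℍ ↦ (2 * π * I)⁻¹ * deriv (x ∘ ofComplex) σ + φ σ * y σ) ∣[(2 : ℤ)] A)
    by_cases hA : A ∈ Gamma0 N
    · rw [slash_eq_self_of_mem φ x y hx hxinv hyinv hA]
      exact h0
    · exact hzero A hA

/-- **The cusp-form argument at level `N` with vanishing order `m`**: if every `S ∈ S₂(Γ₀(N))` with `S/q^m → 0` vanishes, then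
`((2πi)⁻¹x′ + φ·y)/q^m → 0` at `i∞` (plus the cusp hypotheses) forces `x′ = −2πi φ y` on `ℍ`. [cite: DiamondShurman2005, §1.2, Thm. 3.5.1] -/
theorem deriv_eq_of_tendsto_pow_of (φ : CuspForm (Gamma0 N) 2) (m : ℕ) (hm : 0 < m)
    (hS0 : ∀ S : CuspForm (Gamma0 N) 2,
      Tendsto (fun τ : ℍ ↦ S τ / Function.Periodic.qParam 1 (τ : ℂ) ^ m) atImInfty (𝓝 0) → S = 0)
    (x y : ℍ → ℂ) (hx : MDifferentiable 𝓘(ℂ) 𝓘(ℂ) x) (hy : MDifferentiable 𝓘(ℂ) 𝓘(ℂ) y)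
    (hxinv : ∀ γ : SL(2, ℤ), γ ∈ Gamma0 N → ∀ τ : ℍ, x (γ • τ) = x τ)
    (hyinv : ∀ γ : SL(2, ℤ), γ ∈ Gamma0 N → ∀ τ : ℍ, y (γ • τ) = y τ)
    (hzero : ∀ A : SL(2, ℤ), A ∉ Gamma0 N →
      IsZeroAtImInfty ((fun σ : ℍ ↦ (2 * π * I)⁻¹ * deriv (x ∘ ofComplex) σ + φ σ * y σ) ∣[(2 : ℤ)] A))
    (hlim : Tendsto (fun τ : ℍ ↦ ((2 * π * I)⁻¹ * deriv (x ∘ ofComplex) τ + φ τ * y τ)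
      / Function.Periodic.qParam 1 (τ : ℂ) ^ m) atImInfty (𝓝 0)) :
    ∀ τ : ℍ, deriv (x ∘ ofComplex) τ = -(2 * π * I * φ τ) * y τ := by
  have hq : Tendsto (fun τ : ℍ ↦ Function.Periodic.qParam 1 (τ : ℂ) ^ m) atImInfty (𝓝 0) := by
    have h := tendsto_qParam_zpow_atImInfty (m := (m : ℤ)) (by exact_mod_cast hm)
    simpa only [zpow_natCast] using h
  have h0 : IsZeroAtImInfty (fun σ : ℍ ↦ (2 * π * I)⁻¹ * deriv (x ∘ ofComplex) σ + φ σ * y σ) := by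
    have h := hlim.mul hq
    rw [zero_mul] at h
    refine h.congr fun τ ↦ ?_
    exact div_mul_cancel₀ _ (pow_ne_zero _ (Complex.exp_ne_zero _))
  obtain ⟨S, hS⟩ := exists_cuspForm_of' φ x y hx hy hxinv hyinv hzero h0
  have hS' : S = 0 := by
    refine hS0 S (hlim.congr fun τ ↦ ?_)
    rw [hS τ]
  intro τ
  have h := hS τ
  rw [hS', CuspForm.zero_apply] at h
  have h2pi : (2 * π * I : ℂ) ≠ 0 := by simp [Real.pi_ne_zero, I_ne_zero]
  have h' : deriv (x ∘ ofComplex) τ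
      = (2 * π * I) * ((2 * π * I)⁻¹ * deriv (x ∘ ofComplex) τ + φ τ * y τ) - 2 * π * I * φ τ * y τ := by
    field_simp
    ring
  rw [h', ← h]
  ring

end General

/-! ## §2 `x, y` at level `48`: invariance, the cusps with `24 ∤ c`, and the cusp `1/24` via `W = (1 0; 24 1)` -/

/-- Newman's conditions for `x = η₈⁴η₁₂²/(η₄²η₂₄⁴)` in weight `0` (`∏ δ^{|r|} = 1769472²`). [folklore] -/
theorem newmanCond_x48 : NewmanCond 48 (expFn [(4, -2), (8, 4), (12, 2), (24, -4)]) 0 :=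
  ⟨by decide, by decide, by decide, ⟨1769472, by decide⟩⟩

/-- Newman's conditions for `y = η₂η₆η₈³η₁₂²/(η₄²η₂₄⁵)` in weight `0` (`∏ δ^{|r|} = 10616832²`). [folklore] -/
theorem newmanCond_y48 : NewmanCond 48 (expFn [(2, 1), (4, -2), (6, 1), (8, 3), (12, 2), (24, -5)]) 0 :=
  ⟨by decide, by decide, by decide, ⟨10616832, by decide⟩⟩

/-- `x(γτ) = x(τ)` for `γ ∈ Γ₀(48)`. [folklore] -/
theorem x48_smul (γ : SL(2, ℤ)) (hγ : γ ∈ Gamma0 48) (τ : ℍ) :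
    etaQuotient 48 (expFn [(4, -2), (8, 4), (12, 2), (24, -4)]) (γ • τ)
      = etaQuotient 48 (expFn [(4, -2), (8, 4), (12, 2), (24, -4)]) τ := by
  have h := etaQuotient_smul_of_mem_Gamma0 48 (by norm_num) _ 0 ⟨0, by simp⟩ newmanCond_x48 hγ τ
  rwa [zpow_zero, one_mul] at h

/-- `y(γτ) = y(τ)` for `γ ∈ Γ₀(48)`. [folklore] -/
theorem y48_smul (γ : SL(2, ℤ)) (hγ : γ ∈ Gamma0 48) (τ : ℍ) :
    etaQuotient 48 (expFn [(2, 1), (4, -2), (6, 1), (8, 3), (12, 2), (24, -5)]) (γ • τ)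
      = etaQuotient 48 (expFn [(2, 1), (4, -2), (6, 1), (8, 3), (12, 2), (24, -5)]) τ := by
  have h := etaQuotient_smul_of_mem_Gamma0 48 (by norm_num) _ 0 ⟨0, by simp⟩ newmanCond_y48 hγ τ
  rwa [zpow_zero, one_mul] at h

/-- Ligozat's order at level `48` is `≥ 0` at every `c` with `24 ∤ c`, given the values at the divisors `≠ 24, 48`. [cite: Ligozat1975, Ch. 3] -/
theorem cuspOrder24_nonneg_of_not_dvd48 (r : ℕ → ℤ)
    (h : ∀ t ∈ Nat.divisors 48, t ≠ 24 → t ≠ 48 → 0 ≤ cuspOrder24 48 r t) {c : ℤ} (hc : ¬ (24 : ℤ) ∣ c) :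
    0 ≤ cuspOrder24 48 r c := by
  rw [cuspOrder24_eq_gcd]
  have h24 : ¬ 24 ∣ Nat.gcd 48 c.natAbs := fun hd ↦ hc (Int.natCast_dvd.mpr (hd.trans (Nat.gcd_dvd_right _ _)))
  refine h _ (Nat.mem_divisors.mpr ⟨Nat.gcd_dvd_left _ _, by norm_num⟩) ?_ ?_
  · intro h'; apply h24; rw [h']
  · intro h'; apply h24; rw [h']; norm_num

/-- `x ∘ A` is bounded at `i∞` when `24 ∤ c(A)` (Ligozat orders `0,0,0,0,0,2,0,2` at the cusps `1/c`, `c ∣ 48`, `c ≠ 24, 48`). [cite: Ligozat1975, Ch. 3] -/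
theorem isBoundedAtImInfty_x48_smul {A : SL(2, ℤ)} (hA : ¬ (24 : ℤ) ∣ A 1 0) :
    IsBoundedAtImInfty (fun τ : ℍ ↦ etaQuotient 48 (expFn [(4, -2), (8, 4), (12, 2), (24, -4)]) (A • τ)) :=
  isBoundedAtImInfty_etaQuotient_smul 48 (by norm_num) _ (by decide) A
    (cuspOrder24_nonneg_of_not_dvd48 _ (by decide) hA)

/-- `y ∘ A` is bounded at `i∞` when `24 ∤ c(A)` (Ligozat orders `1,1,1,0,1,1,0,1`). [cite: Ligozat1975, Ch. 3] -/
theorem isBoundedAtImInfty_y48_smul {A : SL(2, ℤ)} (hA : ¬ (24 : ℤ) ∣ A 1 0) :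
    IsBoundedAtImInfty (fun τ : ℍ ↦ etaQuotient 48 (expFn [(2, 1), (4, -2), (6, 1), (8, 3), (12, 2), (24, -5)]) (A • τ)) :=
  isBoundedAtImInfty_etaQuotient_smul 48 (by norm_num) _ (by decide) A
    (cuspOrder24_nonneg_of_not_dvd48 _ (by decide) hA)

/-- An `η`-quotient of level `48` supported on the divisors of `24` is the same product at level `24`. [folklore] -/
theorem etaQuotient48_eq_24 (L : List (ℕ × ℤ)) (h16 : expFn L 16 = 0) (h48 : expFn L 48 = 0) (τ : ℍ) :
    etaQuotient 48 (expFn L) τ = etaQuotient 24 (expFn L) τ := by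
  rw [etaQuotient_apply, etaQuotient_apply]
  symm
  refine Finset.prod_subset (Nat.divisors_subset_of_dvd (by norm_num) (by norm_num)) fun t ht hnt ↦ ?_
  rw [show Nat.divisors 48 = {1, 2, 3, 4, 6, 8, 12, 16, 24, 48} by decide] at ht
  rw [show Nat.divisors 24 = {1, 2, 3, 4, 6, 8, 12, 24} by decide] at hnt
  simp only [Finset.mem_insert, Finset.mem_singleton] at ht hnt
  rcases ht with rfl | rfl | rfl | rfl | rfl | rfl | rfl | rfl | rfl | rfl <;> simp_all

/-- **`x∘W = x`** for `W = (1 0; 24 1)` (log period `0`). [cite: Apostol1990, Thm. 3.4] -/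
theorem x48_smul_W (W : SL(2, ℤ)) (h00 : W 0 0 = 1) (h01 : W 0 1 = 0) (h10 : W 1 0 = 24) (h11 : W 1 1 = 1) (τ : ℍ) :
    etaQuotient 48 (expFn [(4, -2), (8, 4), (12, 2), (24, -4)]) (W • τ)
      = etaQuotient 48 (expFn [(4, -2), (8, 4), (12, 2), (24, -4)]) τ := by
  rw [etaQuotient48_eq_24 _ (by decide) (by decide), etaQuotient48_eq_24 _ (by decide) (by decide),
    etaQuotient24_smul_W _ (by decide) W h00 h01 h10 h11 τ]
  have hs : (∑ t ∈ Nat.divisors 24, ((24 / t : ℕ) : ℤ) * expFn [(4, -2), (8, 4), (12, 2), (24, -4)] t : ℤ) = 0 := by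
    decide
  rw [hs]
  simp

/-- **`y∘W = −y`** for `W = (1 0; 24 1)` (log period `−½`). [cite: Apostol1990, Thm. 3.4] -/
theorem y48_smul_W (W : SL(2, ℤ)) (h00 : W 0 0 = 1) (h01 : W 0 1 = 0) (h10 : W 1 0 = 24) (h11 : W 1 1 = 1) (τ : ℍ) :
    etaQuotient 48 (expFn [(2, 1), (4, -2), (6, 1), (8, 3), (12, 2), (24, -5)]) (W • τ)
      = -etaQuotient 48 (expFn [(2, 1), (4, -2), (6, 1), (8, 3), (12, 2), (24, -5)]) τ := by
  rw [etaQuotient48_eq_24 _ (by decide) (by decide), etaQuotient48_eq_24 _ (by decide) (by decide),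
    etaQuotient24_smul_W _ (by decide) W h00 h01 h10 h11 τ]
  have hs : (∑ t ∈ Nat.divisors 24, ((24 / t : ℕ) : ℤ) * expFn [(2, 1), (4, -2), (6, 1), (8, 3), (12, 2), (24, -5)] t
      : ℤ) = 12 := by
    decide
  rw [hs, show (-(π * I / 12 * ((12 : ℤ) : ℂ)) : ℂ) = -(π * I) by push_cast; ring, Complex.exp_neg, Complex.exp_pi_mul_I]
  norm_num

/-- **`A = g·W` with `g ∈ Γ₀(48)`** for `A ∈ SL₂(ℤ)` with `24 ∣ c(A)`, `48 ∤ c(A)` and `W = (1 0; 24 1)`: the cusp `A∞` is the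
cusp `1/24` (`g = AW⁻¹`, `c(g) = c − 24d ≡ 0 (mod 48)` as `c/24` and `d` are odd). [cite: DiamondShurman2005, §3.8] -/
theorem exists_mem_Gamma0_mul_W {A : SL(2, ℤ)} (h24 : (24 : ℤ) ∣ A 1 0) (hA : A ∉ Gamma0 48) :
    ∃ g W : SL(2, ℤ), g ∈ Gamma0 48 ∧ W 0 0 = 1 ∧ W 0 1 = 0 ∧ W 1 0 = 24 ∧ W 1 1 = 1 ∧ A = g * W := by
  let W : SL(2, ℤ) := ⟨!![1, 0; 24, 1], by norm_num [Matrix.det_fin_two_of]⟩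
  have hW00 : W 0 0 = 1 := rfl
  have hW01 : W 0 1 = 0 := rfl
  have hW10 : W 1 0 = 24 := rfl
  have hW11 : W 1 1 = 1 := rfl
  refine ⟨A * W⁻¹, W, ?_, hW00, hW01, hW10, hW11, by rw [inv_mul_cancel_right]⟩
  obtain ⟨m, hm⟩ := h24
  have h48 : ¬ (48 : ℤ) ∣ A 1 0 := fun h ↦ hA (by rw [Gamma0_mem]; exact (ZMod.intCast_zmod_eq_zero_iff_dvd _ 48).mpr h)
  have hdet : A 0 0 * A 1 1 - A 0 1 * A 1 0 = 1 := by
    have h := Matrix.det_fin_two (A : Matrix (Fin 2) (Fin 2) ℤ)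
    rw [A.det_coe] at h
    linarith
  have hmodd : Odd m := by
    rcases Int.even_or_odd m with ⟨k, hk⟩ | hodd
    · exact absurd ⟨k, by rw [hm, hk]; ring⟩ h48
    · exact hodd
  have hdodd : Odd (A 1 1) := by
    have hprod : Odd (A 0 0 * A 1 1) := ⟨A 0 1 * 12 * m, by rw [hm] at hdet; linear_combination hdet⟩
    exact (Int.odd_mul.mp hprod).2
  obtain ⟨i, hi⟩ := hmodd
  obtain ⟨j, hj⟩ := hdodd
  have hg10 : (A * W⁻¹) 1 0 = A 1 0 - 24 * A 1 1 := by
    rw [Matrix.SpecialLinearGroup.SL2_inv_expl]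
    simp [Matrix.mul_apply, Fin.sum_univ_two, W]
    ring
  rw [Gamma0_mem, hg10]
  refine (ZMod.intCast_zmod_eq_zero_iff_dvd _ 48).mpr ⟨i - j, ?_⟩
  rw [hm, hi, hj]
  ring

section Phi

variable (φ : CuspForm (Gamma0 48) 2)
  (hφ : ⇑φ = etaQuotient 48 (expFn [(2, -1), (4, 4), (6, -1), (8, -1), (12, 4), (24, -1)]))
include hφ

/-- **`R₁|A → 0` at `i∞` for every `A ∉ Γ₀(48)`**, `R₁ = (2πi)⁻¹x′ + φ₄₈·2y`, once `R₁ → 0` at `i∞`: at the cusps with `24 ∤ c`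
by boundedness of `x, y`; at the cusp `1/24` because `R₁|A = R₁|W = R₁` (`x∘W = x`, `φ₄₈|W = −φ₄₈`, `y∘W = −y`).
[cite: DiamondShurman2005, §1.2] -/
theorem isZeroAtImInfty_slash_R1 (h0 : IsZeroAtImInfty (fun σ : ℍ ↦ (2 * π * I)⁻¹
      * deriv (etaQuotient 48 (expFn [(4, -2), (8, 4), (12, 2), (24, -4)]) ∘ ofComplex) σ
      + φ σ * (2 * etaQuotient 48 (expFn [(2, 1), (4, -2), (6, 1), (8, 3), (12, 2), (24, -5)]) σ)))
    (A : SL(2, ℤ)) (hA : A ∉ Gamma0 48) :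
    IsZeroAtImInfty ((fun σ : ℍ ↦ (2 * π * I)⁻¹
      * deriv (etaQuotient 48 (expFn [(4, -2), (8, 4), (12, 2), (24, -4)]) ∘ ofComplex) σ
      + φ σ * (2 * etaQuotient 48 (expFn [(2, 1), (4, -2), (6, 1), (8, 3), (12, 2), (24, -5)]) σ)) ∣[(2 : ℤ)] A) := by
  by_cases h24 : (24 : ℤ) ∣ A 1 0
  · obtain ⟨g, W, hg, h00, h01, h10, h11, rfl⟩ := exists_mem_Gamma0_mul_W h24 hA
    rw [SlashAction.slash_mul, slash_eq_self_of_mem φ _ _ (mdifferentiable_etaQuotient 48 _) x48_smul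
      (fun γ hγ τ ↦ by simp only [y48_smul γ hγ τ]) hg]
    have hfun : ((fun σ : ℍ ↦ (2 * π * I)⁻¹
        * deriv (etaQuotient 48 (expFn [(4, -2), (8, 4), (12, 2), (24, -4)]) ∘ ofComplex) σ
        + φ σ * (2 * etaQuotient 48 (expFn [(2, 1), (4, -2), (6, 1), (8, 3), (12, 2), (24, -5)]) σ)) ∣[(2 : ℤ)] W)
        = fun σ : ℍ ↦ (2 * π * I)⁻¹
          * deriv (etaQuotient 48 (expFn [(4, -2), (8, 4), (12, 2), (24, -4)]) ∘ ofComplex) σ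
          + φ σ * (2 * etaQuotient 48 (expFn [(2, 1), (4, -2), (6, 1), (8, 3), (12, 2), (24, -5)]) σ) := by
      funext τ
      rw [slash_two_apply_of φ _ (mdifferentiable_etaQuotient 48 _) W τ,
        show (fun σ : ℍ ↦ etaQuotient 48 (expFn [(4, -2), (8, 4), (12, 2), (24, -4)]) (W • σ))
          = etaQuotient 48 (expFn [(4, -2), (8, 4), (12, 2), (24, -4)]) from funext (x48_smul_W W h00 h01 h10 h11),
        y48_smul_W W h00 h01 h10 h11, hφ, phi48_slash_W W h00 h01 h10 h11]
      ring
    rw [hfun]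
    exact h0
  · exact isZeroAtImInfty_slash_of_isBoundedAtImInfty φ _ _ (mdifferentiable_etaQuotient 48 _) A
      (isBoundedAtImInfty_x48_smul h24) ((isBoundedAtImInfty_y48_smul h24).const_mul_left 2)

/-- **`R₂|A → 0` at `i∞` for every `A ∉ Γ₀(48)`**, `R₂ = (2πi)⁻¹y′ + φ₄₈(3x² − 4x − 3)`, once `R₂ → 0` at `i∞`
(at the cusp `1/24`: `R₂|A = R₂|W = −R₂`). [cite: DiamondShurman2005, §1.2] -/
theorem isZeroAtImInfty_slash_R2 (h0 : IsZeroAtImInfty (fun σ : ℍ ↦ (2 * π * I)⁻¹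
      * deriv (etaQuotient 48 (expFn [(2, 1), (4, -2), (6, 1), (8, 3), (12, 2), (24, -5)]) ∘ ofComplex) σ
      + φ σ * (3 * etaQuotient 48 (expFn [(4, -2), (8, 4), (12, 2), (24, -4)]) σ ^ 2
        - 4 * etaQuotient 48 (expFn [(4, -2), (8, 4), (12, 2), (24, -4)]) σ - 3)))
    (A : SL(2, ℤ)) (hA : A ∉ Gamma0 48) :
    IsZeroAtImInfty ((fun σ : ℍ ↦ (2 * π * I)⁻¹
      * deriv (etaQuotient 48 (expFn [(2, 1), (4, -2), (6, 1), (8, 3), (12, 2), (24, -5)]) ∘ ofComplex) σ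
      + φ σ * (3 * etaQuotient 48 (expFn [(4, -2), (8, 4), (12, 2), (24, -4)]) σ ^ 2
        - 4 * etaQuotient 48 (expFn [(4, -2), (8, 4), (12, 2), (24, -4)]) σ - 3)) ∣[(2 : ℤ)] A) := by
  by_cases h24 : (24 : ℤ) ∣ A 1 0
  · obtain ⟨g, W, hg, h00, h01, h10, h11, rfl⟩ := exists_mem_Gamma0_mul_W h24 hA
    rw [SlashAction.slash_mul, slash_eq_self_of_mem φ _ _ (mdifferentiable_etaQuotient 48 _) y48_smul
      (fun γ hγ τ ↦ by simp only [x48_smul γ hγ τ]) hg]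
    have hyW : (fun σ : ℍ ↦ etaQuotient 48 (expFn [(2, 1), (4, -2), (6, 1), (8, 3), (12, 2), (24, -5)]) (W • σ))
        = fun σ : ℍ ↦ -etaQuotient 48 (expFn [(2, 1), (4, -2), (6, 1), (8, 3), (12, 2), (24, -5)]) σ :=
      funext (y48_smul_W W h00 h01 h10 h11)
    have hderiv : ∀ τ : ℍ, deriv ((fun σ : ℍ ↦ -etaQuotient 48 (expFn [(2, 1), (4, -2), (6, 1), (8, 3), (12, 2), (24, -5)]) σ)
        ∘ ofComplex) τ
        = -deriv (etaQuotient 48 (expFn [(2, 1), (4, -2), (6, 1), (8, 3), (12, 2), (24, -5)]) ∘ ofComplex) τ := by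
      intro τ
      show deriv (-(etaQuotient 48 (expFn [(2, 1), (4, -2), (6, 1), (8, 3), (12, 2), (24, -5)]) ∘ ofComplex)) (τ : ℂ) = _
      exact deriv.neg
    have hfun : ((fun σ : ℍ ↦ (2 * π * I)⁻¹
        * deriv (etaQuotient 48 (expFn [(2, 1), (4, -2), (6, 1), (8, 3), (12, 2), (24, -5)]) ∘ ofComplex) σ
        + φ σ * (3 * etaQuotient 48 (expFn [(4, -2), (8, 4), (12, 2), (24, -4)]) σ ^ 2
          - 4 * etaQuotient 48 (expFn [(4, -2), (8, 4), (12, 2), (24, -4)]) σ - 3)) ∣[(2 : ℤ)] W)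
        = fun σ : ℍ ↦ -((2 * π * I)⁻¹
          * deriv (etaQuotient 48 (expFn [(2, 1), (4, -2), (6, 1), (8, 3), (12, 2), (24, -5)]) ∘ ofComplex) σ
          + φ σ * (3 * etaQuotient 48 (expFn [(4, -2), (8, 4), (12, 2), (24, -4)]) σ ^ 2
            - 4 * etaQuotient 48 (expFn [(4, -2), (8, 4), (12, 2), (24, -4)]) σ - 3)) := by
      funext τ
      rw [slash_two_apply_of φ _ (mdifferentiable_etaQuotient 48 _) W τ, hyW, hderiv τ,
        x48_smul_W W h00 h01 h10 h11, hφ, phi48_slash_W W h00 h01 h10 h11]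
      ring
    rw [hfun]
    exact h0.neg
  · refine isZeroAtImInfty_slash_of_isBoundedAtImInfty φ _ _ (mdifferentiable_etaQuotient 48 _) A
      (isBoundedAtImInfty_y48_smul h24) ?_
    exact ((((isBoundedAtImInfty_x48_smul h24).mul (isBoundedAtImInfty_x48_smul h24)).const_mul_left 3 |>.sub
      ((isBoundedAtImInfty_x48_smul h24).const_mul_left 4)).sub (const_boundedAtFilter atImInfty (3 : ℂ))).congr_left
      fun τ ↦ by simp only [Pi.mul_apply, Function.const_apply]; ring

end Phi

end Summit.BirchSwinnertonDyer.BirchSwinnertonDyer.Theorems.ManinLocalTwoThree.EtaIdentityReductionFortyEight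

end
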